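import Summits.BirchSwinnertonDyer.BirchSwinnertonDyer.Theorems.CMKolyvaginAtInertTwoCMKolyvaginConjectureAtInertTwoShallowGenusDescent
import Literature.NumberTheory.EllipticCurves.RingClassGenusCharacterProofs
import HarnessLib

/-!
# Crux `CMKolyvaginConjectureAtInertTwo` (stmt-BirchSwinnertonDyer-24648), open stub `stub_positiveDepth`:
# at a SHALLOW CM-inert Kolyvagin prime the Kolyvagin generator `σ_ℓ` IS the genus character of `√ℓ`, and the
# crux's clause is a statement about `K[1]`-coordinates on the quadratic twist `ℓ·w² = 4x³ + b₂x² + 2b₄x + b₆`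

Route `CMKolyvaginAtInertTwo` (cell `pub/bsd-eis`, seat `leafhand-bsd-cmkolyvaginatinert-3` g0); helper (`--supports
stmt-BirchSwinnertonDyer-24648 --as helper`). THEOREMS ONLY (no definition, no named fact, no `sorry`); closes nothing.

The predecessor's SHALLOW GENUS DESCENT (p800829, `two_dvd_derivedPoint_iff_exists_anti_of_shallow`): on H₂, at a CM-inert
Zhang–Kolyvagin prime `ℓ ≡ 1 (mod 4)` and any datum `d`, `P_d(ℓ) ∈ 2E(K[ℓ]) ⟺ ∃ Q, σ_ℓ²Q = Q ∧ σ_ℓQ = −Q ∧ 2Q = g_d`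
(`g_d` the genus point), read as "a `K[1]`-point of ONE quadratic twist of `E`" with the twist dictionary NOT formalised
(census of seat -2). This file supplies the dictionary in coordinates, with no new definition:

* §1 `exists_sqrt_σ_eq_neg` — **the Kolyvagin generator is the genus character**: for an odd Zhang–Kolyvagin prime `ℓ`
  (`ℓ ∤ d_K`) and any datum `d` of conductor `ℓ` there is `θ ∈ K[ℓ]` with `θ² = ℓ* = (−1)^{(ℓ−1)/2}ℓ`, `θ ≠ 0` and
  **`σ_ℓ θ = −θ`** — the tree THEOREM `sqrt_pStar_mem_ringClassField_holds` (Cox 9.18/8.10: `√ℓ* ∈ K[ℓ] ∖ K[1]`, moved by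
  some element of `Gal(K[ℓ]/K[1])`) plus `Gal(K[ℓ]/K[1]) = ⟨σ_ℓ⟩` (`d.zpowers_σ`); for `ℓ ≡ 1 (mod 4)`, `θ² = ℓ`
  (`exists_sqrt_σ_eq_neg_of_mod_four_eq_one`).
* §2 `two_dvd_derivedPoint_iff_exists_anti` — the anti-form needs only `σ_ℓ Q = −Q` (then `σ_ℓ² Q = Q` is automatic).
* §3 the coordinate dictionary for an affine `Q = (x, y) ∈ E(K[ℓ])` and `σ = σ_ℓ`, `θ` as in §1:
  `σQ = −Q ⟺ σx = x ∧ σy = −y − a₁x − a₃` (`pointGalHom_some_eq_neg_iff`) `⟺ σx = x ∧ σw = w` for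
  **`w = (2y + a₁x + a₃)/θ`** (`anti_iff_fixed_coords`), and ALWAYS `ℓ*·w² = 4x³ + b₂x² + 2b₄x + b₆` (`twist_equation`):
  the `σ_ℓ`-anti-invariant affine points of `E(K[ℓ])` are exactly the points `(x, (θw − a₁x − a₃)/2)` with `(x, w)` a
  `σ_ℓ`-FIXED solution of the quadratic-twist equation `E^{(ℓ*)} : ℓ* w² = 4x³ + b₂x² + 2b₄x + b₆` — and `Fix(σ_ℓ) = K[1]`
  since `⟨σ_ℓ⟩ = Gal(K[ℓ]/K[1])`.
* §4 `two_dvd_derivedPoint_iff_exists_twistCoords` — **the crux's clause at a shallow prime, in twist coordinates**: on H₂,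
  `ℓ ≡ 1 (mod 4)` CM-inert Zhang–Kolyvagin, any datum `d`: `P_d(ℓ) ∈ 2E(K[ℓ])` iff the genus point `g_d` is `2Q` for a point
  `Q` which is `0` or affine `(x, y)` with `σ_ℓ x = x` and `σ_ℓ w = w`, `w = (2y + a₁x + a₃)/θ`, `θ² = ℓ`, `σ_ℓθ = −θ` — i.e.
  `g_d ∈ 2·ι_θ(E^{(ℓ)}(K[1]))`. So the shallow residue of Kolyvagin's conjecture at CM-inert `2` is, level by level, the
  statement that the genus Heegner point is not twice the image of a `K[1]`-point of the twist `E^{(ℓ)}`.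

HONEST FRAMING: compositions of tree theorems and coordinate algebra; the non-vanishing itself is untouched; no stub or
item is closed; BSD is proved for no curve. Beyond-print theorem: no.

References: [cite: Cox2013, Thm. 9.18, Thm. 8.10, §9.A] [cite: SilvermanAEC2009, III.1 (b₂,b₄,b₆), III.2.3, X.2 Prop. 2.4,
X.5 Cor. 5.4] [cite: GrossLMS1991, §3 (3.5), §4 (4.1)] [cite: WZhang2014, §3.7 (M(ℓ))].
-/

set_option linter.dupNamespace false -- `Summit.BirchSwinnertonDyer.BirchSwinnertonDyer.Theorems.…` (summit = sub)
set_option autoImplicit false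

noncomputable section

open scoped Classical

namespace Summit.BirchSwinnertonDyer.BirchSwinnertonDyer.Theorems.CMKolyvaginConjecturePositiveDepth

open Finset WeierstrassCurve NumberField Literature.NumberTheory.EllipticCurves
  Literature.NumberTheory.EllipticCurves.ModularForms
  Literature.NumberTheory.EllipticCurves.Rank1Residual

variable {K : Type} [Field K] [NumberField K]

/-! ## §1 The Kolyvagin generator `σ_ℓ` negates `√ℓ*` -/

/-- **`σ_ℓ(√ℓ*) = −√ℓ*`.** For `K` imaginary quadratic, `ι : K → ℂ`, an odd prime `ℓ` with `ℓ ∤ d_K` (e.g. a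
Zhang–Kolyvagin prime at `2`) and any Kolyvagin datum `d` of conductor `ℓ`: there is `θ ∈ K[ℓ]` with `θ² = ℓ*`, `θ ≠ 0` and
`σ_ℓ θ = −θ`. (`√ℓ* ∈ K[ℓ]` is moved by some `τ ∈ Gal(K[ℓ]/K[1])` — tree theorem `sqrt_pStar_mem_ringClassField_holds`;
`Gal(K[ℓ]/K[1]) = ⟨σ_ℓ⟩`, and `σ_ℓ θ ∈ {±θ}`, so `σ_ℓ θ = θ` would make every power fix `θ`.)
[cite: Cox2013, Thm. 9.18, Thm. 8.10, §9.A] [cite: SilvermanAEC2009, X.2 Prop. 2.4 (proof)] -/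
theorem exists_sqrt_σ_eq_neg (hK : IsImaginaryQuadratic K) {N : ℕ} [NeZero N] {W : WeierstrassCurve ℚ}
    {Dt : ModularParametrizationData W N} {β : ℤ} {ι : K →+* ℂ} {ℓ : ℕ} (hℓ : ℓ.Prime) (hℓ2 : ℓ ≠ 2)
    (hℓd : ¬ ((ℓ : ℤ) ∣ NumberField.discr K)) (d : KolyvaginHeegnerData Dt β ι ℓ) :
    ∃ θ : ringClassField K ι ℓ, θ ^ 2 = algebraMap ℚ (ringClassField K ι ℓ) ((-1 : ℚ) ^ (ℓ / 2) * ℓ) ∧ θ ≠ 0 ∧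
      d.σ ℓ θ = -θ := by
  obtain ⟨θ, hθ2, τ, hτ, hτθ⟩ := sqrt_pStar_mem_ringClassField_holds K hK ι ℓ hℓ hℓ2 hℓd
  have hθ : θ ≠ 0 := ne_zero_of_sq_eq_pStar hℓ hθ2
  refine ⟨θ, hθ2, hθ, ?_⟩
  rcases algEquiv_apply_eq_or_eq_neg_of_sq_eq hθ2 (d.σ ℓ) with hfix | hneg
  · -- `σ_ℓ θ = θ` would force `τ θ = θ`, contradicting `τ θ = −θ ≠ θ`
    exfalso
    have hℓmem : ℓ ∈ ℓ.primeFactors := Nat.mem_primeFactors.mpr ⟨hℓ, dvd_rfl, hℓ.ne_zero⟩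
    have hτz : τ ∈ Subgroup.zpowers (d.σ ℓ) := by
      rw [d.zpowers_σ ℓ hℓmem, Nat.div_self hℓ.pos]
      exact hτ
    obtain ⟨k, rfl⟩ := Subgroup.mem_zpowers_iff.mp hτz
    have hstab : d.σ ℓ ∈ MulAction.stabilizer (ringClassField K ι ℓ ≃ₐ[ℚ] ringClassField K ι ℓ) θ := hfix
    have hk : (d.σ ℓ) ^ k ∈ MulAction.stabilizer (ringClassField K ι ℓ ≃ₐ[ℚ] ringClassField K ι ℓ) θ :=
      Subgroup.zpow_mem _ hstab k
    rw [MulAction.mem_stabilizer_iff] at hk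
    exact ne_neg_of_ne_zero hθ (hk.symm.trans hτθ)
  · exact hneg

/-- **At a SHALLOW prime (`ℓ ≡ 1 (mod 4)`): `θ² = ℓ`, `σ_ℓ θ = −θ`** (`ℓ* = ℓ`). [cite: Cox2013, Thm. 9.18, §9.A] -/
theorem exists_sqrt_σ_eq_neg_of_mod_four_eq_one (hK : IsImaginaryQuadratic K) {N : ℕ} [NeZero N]
    {W : WeierstrassCurve ℚ} {Dt : ModularParametrizationData W N} {β : ℤ} {ι : K →+* ℂ} {ℓ : ℕ} (hℓ : ℓ.Prime)
    (hℓ4 : ℓ % 4 = 1) (hℓd : ¬ ((ℓ : ℤ) ∣ NumberField.discr K)) (d : KolyvaginHeegnerData Dt β ι ℓ) :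
    ∃ θ : ringClassField K ι ℓ, θ ^ 2 = algebraMap ℚ (ringClassField K ι ℓ) ℓ ∧ θ ≠ 0 ∧ d.σ ℓ θ = -θ := by
  have hℓ2 : ℓ ≠ 2 := by omega
  obtain ⟨θ, hθ2, hθ, hσ⟩ := exists_sqrt_σ_eq_neg hK hℓ hℓ2 hℓd d
  refine ⟨θ, ?_, hθ, hσ⟩
  have heven : Even (ℓ / 2) := ⟨ℓ / 4, by omega⟩
  rw [hθ2, heven.neg_one_pow, one_mul]

/-! ## §2 The anti-form needs only `σ_ℓ Q = −Q` -/

/-- **Shallow genus descent on H₂, short form**: `P_d(ℓ) ∈ 2E(K[ℓ]) ⟺ ∃ Q, σ_ℓ Q = −Q ∧ 2Q = g_d` (the condition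
`σ_ℓ² Q = Q` of p800829 follows from `σ_ℓ Q = −Q`). Frame: H₂ (`W/ℚ` globally minimal with CM, `2` inert in `F`, `ρ̄_{E,2}`
onto), `K` imaginary quadratic with odd `d_K ≠ −3`, Heegner for `N_E`, `ℓ ≡ 1 (mod 4)` a CM-inert Zhang–Kolyvagin prime
at `2`. [cite: GrossLMS1991, §3 (3.5), §4 (4.1)] [cite: WZhang2014, §3.7 (M(ℓ))] -/
theorem two_dvd_derivedPoint_iff_exists_anti (W : WeierstrassCurve ℚ) [W.IsElliptic] [W.IsGloballyMinimal]
    [NeZero (W.conductorNorm ℤ)] (hCM : W.HasCM) (hin : CMInert W 2) (hρ : W.HasSurjectiveModNGaloisRep (2 : ℤ))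
    (hK : IsImaginaryQuadratic K) (hodd : Odd (NumberField.discr K)) (h3 : NumberField.discr K ≠ -3)
    (hH : SatisfiesHeegnerHypothesis (W.conductorNorm ℤ) K)
    {Dt : ModularParametrizationData W (W.conductorNorm ℤ)} {β : ℤ} {ι : K →+* ℂ} {ℓ : ℕ}
    (hℓK : Zhang2014.IsKolyvaginPrime (W.conductorNorm ℤ) W K 2 ℓ) (hℓF : CMInert W ℓ) (hℓ4 : ℓ % 4 = 1)
    (d : KolyvaginHeegnerData Dt β ι ℓ) :
    (∃ Q : (W.baseChange (ringClassField K ι ℓ)).toAffine.Point, (2 : ℤ) • Q = d.derivedPoint) ↔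
      ∃ Q : (W.baseChange (ringClassField K ι ℓ)).toAffine.Point,
        pointGalHom W (ringClassField K ι ℓ) (d.σ ℓ) Q = -Q ∧ (2 : ℤ) • Q =
          ∑ s ∈ d.S, pointGalHom W (ringClassField K ι ℓ) s
            (∑ k ∈ range ((ℓ + 1) / 2), pointGalHom W (ringClassField K ι ℓ) ((d.σ ℓ ^ 2) ^ k) d.y) := by
  rw [two_dvd_derivedPoint_iff_exists_anti_of_shallow W hCM hin hρ hK hodd h3 hH hℓK hℓF hℓ4 d]
  refine ⟨fun ⟨Q, _, hanti, hQ⟩ ↦ ⟨Q, hanti, hQ⟩, fun ⟨Q, hanti, hQ⟩ ↦ ⟨Q, ?_, hanti, hQ⟩⟩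
  rw [pow_two, map_mul, AddMonoid.End.coe_mul, Function.comp_apply, hanti, map_neg, hanti, neg_neg]

/-! ## §3 The coordinate dictionary: `σ`-anti-invariant points = `σ`-fixed points of the twist `ℓ* w² = 4x³+b₂x²+2b₄x+b₆` -/

section Coordinates

variable (W : WeierstrassCurve ℚ) {L : Type} [Field L] [Algebra ℚ L]

/-- **`σQ = −Q` in coordinates**: for an affine point `Q = (x, y)` of `E(L)` and `σ ∈ Aut(L/ℚ)`,
`σQ = −Q ⟺ σx = x ∧ σy = −y − a₁x − a₃`. [cite: SilvermanAEC2009, III.2.3 (negation formula)] -/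
theorem pointGalHom_some_eq_neg_iff (σ : L ≃ₐ[ℚ] L) {x y : L} (h : (W.baseChange L).toAffine.Nonsingular x y) :
    pointGalHom W L σ (.some x y h) = -(.some x y h) ↔
      σ x = x ∧ σ y = -y - (W.baseChange L).toAffine.a₁ * x - (W.baseChange L).toAffine.a₃ := by
  rw [pointGalHom_apply, WeierstrassCurve.Affine.Point.map_some, WeierstrassCurve.Affine.Point.neg_some,
    WeierstrassCurve.Affine.Point.some.injEq, WeierstrassCurve.Affine.negY]
  exact Iff.rfl

/-- **The anti-invariant coordinates are the `σ`-fixed twist coordinates**: with `θ ≠ 0`, `σθ = −θ`, for `x, y ∈ L`: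
`(σx = x ∧ σy = −y − a₁x − a₃) ⟺ (σx = x ∧ σw = w)` where `w = (2y + a₁x + a₃)/θ`.
[cite: SilvermanAEC2009, X.2 Prop. 2.4 (proof), X.5 Cor. 5.4] -/
theorem anti_iff_fixed_coords [CharZero L] (σ : L ≃ₐ[ℚ] L) {θ : L} (hθ : θ ≠ 0) (hσθ : σ θ = -θ) (x y : L) :
    (σ x = x ∧ σ y = -y - (W.baseChange L).toAffine.a₁ * x - (W.baseChange L).toAffine.a₃) ↔
      (σ x = x ∧ σ ((2 * y + (W.baseChange L).toAffine.a₁ * x + (W.baseChange L).toAffine.a₃) / θ) =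
        (2 * y + (W.baseChange L).toAffine.a₁ * x + (W.baseChange L).toAffine.a₃) / θ) := by
  have ha₁ : σ (W.baseChange L).toAffine.a₁ = (W.baseChange L).toAffine.a₁ := by
    show σ (algebraMap ℚ L W.a₁) = algebraMap ℚ L W.a₁
    exact σ.commutes _
  have ha₃ : σ (W.baseChange L).toAffine.a₃ = (W.baseChange L).toAffine.a₃ := by
    show σ (algebraMap ℚ L W.a₃) = algebraMap ℚ L W.a₃
    exact σ.commutes _
  refine and_congr_right fun hx ↦ ?_
  rw [map_div₀, map_add, map_add, map_mul, map_mul, map_ofNat, hσθ, ha₁, ha₃, hx]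
  have hθ' : -θ ≠ 0 := neg_ne_zero.mpr hθ
  rw [div_eq_div_iff hθ' hθ]
  constructor
  · intro hy
    rw [hy]
    ring
  · intro h
    have h' : (σ y + y + (W.baseChange L).toAffine.a₁ * x + (W.baseChange L).toAffine.a₃) * (2 * θ) = 0 := by
      linear_combination h
    rcases mul_eq_zero.mp h' with h1 | h1
    · linear_combination h1
    · exact absurd h1 (mul_ne_zero two_ne_zero hθ)

/-- **The twist equation**: for an affine point `(x, y)` of `E(L)` and `θ² = c`, the coordinate `w = (2y + a₁x + a₃)/θ`
satisfies `c·w² = 4x³ + b₂x² + 2b₄x + b₆` — the completed-square equation of the quadratic twist `E^{(c)}`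
(`(2y + a₁x + a₃)² = 4x³ + b₂x² + 2b₄x + b₆` on `E`). [cite: SilvermanAEC2009, III.1 (b₂, b₄, b₆), X.5 Cor. 5.4] -/
theorem twist_equation {θ : L} (hθ : θ ≠ 0) {c : ℚ} (hθ2 : θ ^ 2 = algebraMap ℚ L c) {x y : L}
    (h : (W.baseChange L).toAffine.Equation x y) :
    algebraMap ℚ L c * ((2 * y + (W.baseChange L).toAffine.a₁ * x + (W.baseChange L).toAffine.a₃) / θ) ^ 2 =
      4 * x ^ 3 + (W.baseChange L).b₂ * x ^ 2 + 2 * (W.baseChange L).b₄ * x + (W.baseChange L).b₆ := by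
  rw [WeierstrassCurve.Affine.equation_iff] at h
  rw [← hθ2, div_pow, mul_div_assoc', mul_comm (θ ^ 2), mul_div_assoc, div_self (pow_ne_zero 2 hθ), mul_one]
  simp only [WeierstrassCurve.b₂, WeierstrassCurve.b₄, WeierstrassCurve.b₆]
  have e : (W.baseChange L).toAffine.a₁ = (W.baseChange L).a₁ := rfl
  have e₂ : (W.baseChange L).toAffine.a₂ = (W.baseChange L).a₂ := rfl
  have e₃ : (W.baseChange L).toAffine.a₃ = (W.baseChange L).a₃ := rfl
  have e₄ : (W.baseChange L).toAffine.a₄ = (W.baseChange L).a₄ := rfl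
  have e₆ : (W.baseChange L).toAffine.a₆ = (W.baseChange L).a₆ := rfl
  rw [e, e₂, e₃, e₄, e₆] at h
  rw [e, e₃]
  linear_combination (4 : L) * h

end Coordinates

/-! ## §4 The crux's clause at a shallow prime in twist coordinates -/

/-- **Kolyvagin's clause at a shallow CM-inert prime, in twist coordinates.** On H₂ (`W/ℚ` globally minimal with CM, `2`
inert in `F`, `ρ̄_{E,2}` onto), `K` imaginary quadratic with odd `d_K ≠ −3` and Heegner for `N_E`, `ℓ ≡ 1 (mod 4)` a CM-inert
Zhang–Kolyvagin prime at `2`, `d` any datum of conductor `ℓ`, and `θ ∈ K[ℓ]` with `θ ≠ 0`, `σ_ℓθ = −θ` (exists with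
`θ² = ℓ`, §1): **`P_d(ℓ) ∈ 2E(K[ℓ])` iff `g_d = 2Q` for a point `Q ∈ E(K[ℓ])` which is `O` or an affine point `(x, y)`
whose twist coordinates `x` and `w = (2y + a₁x + a₃)/θ` are FIXED by `σ_ℓ`** (hence lie in `K[1] = K[ℓ]^{⟨σ_ℓ⟩}`, and
`(x, w)` is a `K[1]`-point of `E^{(ℓ)} : ℓw² = 4x³ + b₂x² + 2b₄x + b₆` by `twist_equation`).
[cite: GrossLMS1991, §3 (3.5), §4 (4.1)] [cite: SilvermanAEC2009, X.5 Cor. 5.4] [cite: Cox2013, §9.A] -/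
theorem two_dvd_derivedPoint_iff_exists_twistCoords (W : WeierstrassCurve ℚ) [W.IsElliptic] [W.IsGloballyMinimal]
    [NeZero (W.conductorNorm ℤ)] (hCM : W.HasCM) (hin : CMInert W 2) (hρ : W.HasSurjectiveModNGaloisRep (2 : ℤ))
    (hK : IsImaginaryQuadratic K) (hodd : Odd (NumberField.discr K)) (h3 : NumberField.discr K ≠ -3)
    (hH : SatisfiesHeegnerHypothesis (W.conductorNorm ℤ) K)
    {Dt : ModularParametrizationData W (W.conductorNorm ℤ)} {β : ℤ} {ι : K →+* ℂ} {ℓ : ℕ}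
    (hℓK : Zhang2014.IsKolyvaginPrime (W.conductorNorm ℤ) W K 2 ℓ) (hℓF : CMInert W ℓ) (hℓ4 : ℓ % 4 = 1)
    (d : KolyvaginHeegnerData Dt β ι ℓ) {θ : ringClassField K ι ℓ} (hθ : θ ≠ 0) (hσθ : d.σ ℓ θ = -θ) :
    (∃ Q : (W.baseChange (ringClassField K ι ℓ)).toAffine.Point, (2 : ℤ) • Q = d.derivedPoint) ↔
      ∃ Q : (W.baseChange (ringClassField K ι ℓ)).toAffine.Point,
        (2 : ℤ) • Q = ∑ s ∈ d.S, pointGalHom W (ringClassField K ι ℓ) s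
            (∑ k ∈ range ((ℓ + 1) / 2), pointGalHom W (ringClassField K ι ℓ) ((d.σ ℓ ^ 2) ^ k) d.y) ∧
        ∀ (x y : ringClassField K ι ℓ) (h : (W.baseChange (ringClassField K ι ℓ)).toAffine.Nonsingular x y),
          Q = .some x y h →
            d.σ ℓ x = x ∧
              d.σ ℓ ((2 * y + (W.baseChange (ringClassField K ι ℓ)).toAffine.a₁ * x +
                  (W.baseChange (ringClassField K ι ℓ)).toAffine.a₃) / θ) =
                (2 * y + (W.baseChange (ringClassField K ι ℓ)).toAffine.a₁ * x +
                  (W.baseChange (ringClassField K ι ℓ)).toAffine.a₃) / θ := by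
  rw [two_dvd_derivedPoint_iff_exists_anti W hCM hin hρ hK hodd h3 hH hℓK hℓF hℓ4 d]
  constructor
  · rintro ⟨Q, hanti, hQ⟩
    refine ⟨Q, hQ, fun x y h hQe ↦ ?_⟩
    subst hQe
    exact (anti_iff_fixed_coords W (d.σ ℓ) hθ hσθ x y).mp
      ((pointGalHom_some_eq_neg_iff W (d.σ ℓ) h).mp hanti)
  · rintro ⟨Q, hQ, hcoord⟩
    refine ⟨Q, ?_, hQ⟩
    rcases Q with _ | ⟨x, y, h⟩
    · exact (map_zero _).trans neg_zero.symm
    · exact (pointGalHom_some_eq_neg_iff W (d.σ ℓ) h).mpr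
        ((anti_iff_fixed_coords W (d.σ ℓ) hθ hσθ x y).mpr (hcoord x y h rfl))

/-! ## §5 `Fix(σ_ℓ) = K[1]`: the twist coordinates lie in the Hilbert class field (appended, same seat) -/

/-- **`σ_ℓ x = x ⟺ x ∈ K[1]`** for `x ∈ K[ℓ]` (`ℓ` prime, any datum `d` of conductor `ℓ`, `K` imaginary quadratic): the
Kolyvagin generator generates `Gal(K[ℓ]/K[1])` (`d.zpowers_σ`), and `K[1]` is the fixed field of `Gal(K[ℓ]/K[1])` by the
Galois correspondence for the Galois extension `K[ℓ]/K` (tree `finiteDimensional_and_isGalois_ringClassField`, Mathlib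
`IsGalois.fixedField_fixingSubgroup`; same pattern as `sqrt_pStar_mem_ringClassField_holds`). [cite: Cox2013, §9.A, Thm. 11.1] -/
theorem σ_apply_eq_self_iff_coe_mem_ringClassField_one (hK : IsImaginaryQuadratic K) {N : ℕ} [NeZero N]
    {W : WeierstrassCurve ℚ} {Dt : ModularParametrizationData W N} {β : ℤ} {ι : K →+* ℂ} {ℓ : ℕ} (hℓ : ℓ.Prime)
    (d : KolyvaginHeegnerData Dt β ι ℓ) (x : ringClassField K ι ℓ) :
    d.σ ℓ x = x ↔ (x : ℂ) ∈ ringClassField K ι 1 := by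
  have hℓmem : ℓ ∈ ℓ.primeFactors := Nat.mem_primeFactors.mpr ⟨hℓ, dvd_rfl, hℓ.ne_zero⟩
  have hz : Subgroup.zpowers (d.σ ℓ) = ringClassGalOver ι ℓ 1 := by
    rw [d.zpowers_σ ℓ hℓmem, Nat.div_self hℓ.pos]
  constructor
  · intro hfix
    haveI := (finiteDimensional_and_isGalois_ringClassField hK ι hℓ.ne_zero).1
    haveI := (finiteDimensional_and_isGalois_ringClassField hK ι hℓ.ne_zero).2
    let S : Subfield (ringClassField K ι ℓ) := Subfield.comap (ringClassField K ι ℓ).subtype (ringClassField K ι 1)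
    have hSmem : ∀ y : ringClassField K ι ℓ, y ∈ S ↔ (y : ℂ) ∈ ringClassField K ι 1 := fun y ↦ Iff.rfl
    let M : IntermediateField K (ringClassField K ι ℓ) := S.toIntermediateField fun k ↦ (hSmem _).mpr (by
      rw [coe_algebraMap_ringClassField]
      exact apply_mem_ringClassField ι 1 k)
    have hMmem : ∀ y : ringClassField K ι ℓ, y ∈ M ↔ (y : ℂ) ∈ ringClassField K ι 1 := fun y ↦ Iff.rfl
    rw [← hMmem, ← IsGalois.fixedField_fixingSubgroup M, IntermediateField.mem_fixedField_iff]
    intro τ hτ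
    have hτ' : τ.restrictScalars ℚ ∈ ringClassGalOver ι ℓ 1 := by
      rw [ringClassGalOver, mem_fixingSubgroup_iff]
      intro y hy
      rw [AlgEquiv.smul_def, AlgEquiv.restrictScalars_apply]
      exact (IntermediateField.mem_fixingSubgroup_iff M τ).mp hτ y ((hMmem y).mpr hy)
    rw [← hz] at hτ'
    obtain ⟨k, hk⟩ := Subgroup.mem_zpowers_iff.mp hτ'
    have hstab : d.σ ℓ ∈ MulAction.stabilizer (ringClassField K ι ℓ ≃ₐ[ℚ] ringClassField K ι ℓ) x := hfix
    have hk' : (d.σ ℓ) ^ k ∈ MulAction.stabilizer (ringClassField K ι ℓ ≃ₐ[ℚ] ringClassField K ι ℓ) x :=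
      Subgroup.zpow_mem _ hstab k
    rw [hk, MulAction.mem_stabilizer_iff, AlgEquiv.smul_def, AlgEquiv.restrictScalars_apply] at hk'
    exact hk'
  · intro hx
    have hσ : d.σ ℓ ∈ ringClassGalOver ι ℓ 1 := hz ▸ Subgroup.mem_zpowers (d.σ ℓ)
    rw [ringClassGalOver, mem_fixingSubgroup_iff] at hσ
    simpa only [AlgEquiv.smul_def] using hσ x hx

/-- **Kolyvagin's clause at a shallow CM-inert prime = a statement about `K[1]`-points of `E^{(ℓ)}`.** Same frame as
`two_dvd_derivedPoint_iff_exists_twistCoords` (H₂, `ℓ ≡ 1 (mod 4)` CM-inert Zhang–Kolyvagin, any datum `d`, `θ ∈ K[ℓ]` with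
`θ ≠ 0`, `σ_ℓθ = −θ`; by §1 one may take `θ² = ℓ`): **`P_d(ℓ) ∈ 2E(K[ℓ])` iff the genus point `g_d` is `2Q` for a point
`Q ∈ E(K[ℓ])` which is `O` or affine `(x, y)` with `x ∈ K[1]` and `w = (2y + a₁x + a₃)/θ ∈ K[1]`** — and `(x, w)` then
satisfies `ℓ·w² = 4x³ + b₂x² + 2b₄x + b₆` (`twist_equation`): a `K[1]`-rational point of the quadratic twist `E^{(ℓ)}`,
transported to `E(K[1](√ℓ))` by `(x, w) ↦ (x, (θw − a₁x − a₃)/2)` (Silverman X.5.4). This is the formal twist dictionary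
for the shallow residue of crux 24648. [cite: GrossLMS1991, §3 (3.5), §4 (4.1)] [cite: SilvermanAEC2009, X.5 Cor. 5.4]
[cite: Cox2013, §9.A, Thm. 9.18] -/
theorem two_dvd_derivedPoint_iff_exists_ringClassField_one_twistCoords (W : WeierstrassCurve ℚ) [W.IsElliptic]
    [W.IsGloballyMinimal] [NeZero (W.conductorNorm ℤ)] (hCM : W.HasCM) (hin : CMInert W 2)
    (hρ : W.HasSurjectiveModNGaloisRep (2 : ℤ)) (hK : IsImaginaryQuadratic K) (hodd : Odd (NumberField.discr K))
    (h3 : NumberField.discr K ≠ -3) (hH : SatisfiesHeegnerHypothesis (W.conductorNorm ℤ) K)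
    {Dt : ModularParametrizationData W (W.conductorNorm ℤ)} {β : ℤ} {ι : K →+* ℂ} {ℓ : ℕ}
    (hℓK : Zhang2014.IsKolyvaginPrime (W.conductorNorm ℤ) W K 2 ℓ) (hℓF : CMInert W ℓ) (hℓ4 : ℓ % 4 = 1)
    (d : KolyvaginHeegnerData Dt β ι ℓ) {θ : ringClassField K ι ℓ} (hθ : θ ≠ 0) (hσθ : d.σ ℓ θ = -θ) :
    (∃ Q : (W.baseChange (ringClassField K ι ℓ)).toAffine.Point, (2 : ℤ) • Q = d.derivedPoint) ↔
      ∃ Q : (W.baseChange (ringClassField K ι ℓ)).toAffine.Point,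
        (2 : ℤ) • Q = ∑ s ∈ d.S, pointGalHom W (ringClassField K ι ℓ) s
            (∑ k ∈ range ((ℓ + 1) / 2), pointGalHom W (ringClassField K ι ℓ) ((d.σ ℓ ^ 2) ^ k) d.y) ∧
        ∀ (x y : ringClassField K ι ℓ) (h : (W.baseChange (ringClassField K ι ℓ)).toAffine.Nonsingular x y),
          Q = .some x y h →
            (x : ℂ) ∈ ringClassField K ι 1 ∧
              (((2 * y + (W.baseChange (ringClassField K ι ℓ)).toAffine.a₁ * x +
                  (W.baseChange (ringClassField K ι ℓ)).toAffine.a₃) / θ : ringClassField K ι ℓ) : ℂ) ∈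
                ringClassField K ι 1 := by
  rw [two_dvd_derivedPoint_iff_exists_twistCoords W hCM hin hρ hK hodd h3 hH hℓK hℓF hℓ4 d hθ hσθ]
  simp only [σ_apply_eq_self_iff_coe_mem_ringClassField_one hK hℓK.1 d]

/-! ## §6 The genus points themselves live on the twist over `K[1]` (appended, same seat) -/

/-- **Any `σ_ℓ`-anti-invariant point of `E(K[ℓ])` has its twist coordinates in `K[1]`** (packaging of §3 + §5): for
`ℓ` prime, a datum `d`, `θ ≠ 0` with `σ_ℓθ = −θ`, and `P ∈ E(K[ℓ])` with `σ_ℓ P = −P`: `P = O` or `P = (x, y)` with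
`x ∈ K[1]` and `(2y + a₁x + a₃)/θ ∈ K[1]`. [cite: SilvermanAEC2009, X.2 Prop. 2.4 (proof), X.5 Cor. 5.4] [cite: Cox2013, §9.A] -/
theorem twistCoords_mem_of_anti (hK : IsImaginaryQuadratic K) (W : WeierstrassCurve ℚ) {N : ℕ} [NeZero N]
    {Dt : ModularParametrizationData W N} {β : ℤ} {ι : K →+* ℂ} {ℓ : ℕ} (hℓ : ℓ.Prime)
    (d : KolyvaginHeegnerData Dt β ι ℓ) {θ : ringClassField K ι ℓ} (hθ : θ ≠ 0) (hσθ : d.σ ℓ θ = -θ)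
    {P : (W.baseChange (ringClassField K ι ℓ)).toAffine.Point}
    (hP : pointGalHom W (ringClassField K ι ℓ) (d.σ ℓ) P = -P) :
    ∀ (x y : ringClassField K ι ℓ) (h : (W.baseChange (ringClassField K ι ℓ)).toAffine.Nonsingular x y),
      P = .some x y h →
        (x : ℂ) ∈ ringClassField K ι 1 ∧
          (((2 * y + (W.baseChange (ringClassField K ι ℓ)).toAffine.a₁ * x +
              (W.baseChange (ringClassField K ι ℓ)).toAffine.a₃) / θ : ringClassField K ι ℓ) : ℂ) ∈
            ringClassField K ι 1 := by
  intro x y h hPe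
  subst hPe
  rw [← σ_apply_eq_self_iff_coe_mem_ringClassField_one hK hℓ d,
    ← σ_apply_eq_self_iff_coe_mem_ringClassField_one hK hℓ d]
  exact (anti_iff_fixed_coords W (d.σ ℓ) hθ hσθ x y).mp ((pointGalHom_some_eq_neg_iff W (d.σ ℓ) h).mp hP)

/-- **The genus half-trace `A = Σ_{k<(ℓ+1)/2} σ_ℓ^{2k} y(ℓ)` is (the transport of) a `K[1]`-point of `E^{(ℓ*)}`.** Frame:
`W/ℚ` globally minimal with CM, `K` imaginary quadratic with odd `d_K ≠ −3`, Heegner for `N_E`, `ℓ` a CM-inert Zhang–Kolyvagin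
prime at `2`, any datum `d`, `θ ≠ 0` with `σ_ℓθ = −θ` (§1): since `σ_ℓ A = −A` (p794939 `pointGalHom_σ_halfTrace_eq_neg`),
`A = O` or `A = (x, y)` with `x ∈ K[1]`, `(2y + a₁x + a₃)/θ ∈ K[1]` (and `ℓ*·w² = 4x³ + b₂x² + 2b₄x + b₆`, `twist_equation`).
[cite: GrossLMS1991, §3 (3.5), Prop. 3.7 (1)] [cite: SilvermanAEC2009, X.5 Cor. 5.4] -/
theorem halfTrace_twistCoords_mem (W : WeierstrassCurve ℚ) [W.IsElliptic] [W.IsGloballyMinimal]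
    [NeZero (W.conductorNorm ℤ)] (hCM : W.HasCM) (hK : IsImaginaryQuadratic K)
    (hodd : Odd (NumberField.discr K)) (h3 : NumberField.discr K ≠ -3)
    (hH : SatisfiesHeegnerHypothesis (W.conductorNorm ℤ) K)
    {Dt : ModularParametrizationData W (W.conductorNorm ℤ)} {β : ℤ} {ι : K →+* ℂ} {ℓ : ℕ}
    (hℓK : Zhang2014.IsKolyvaginPrime (W.conductorNorm ℤ) W K 2 ℓ) (hℓF : CMInert W ℓ)
    (d : KolyvaginHeegnerData Dt β ι ℓ) {θ : ringClassField K ι ℓ} (hθ : θ ≠ 0) (hσθ : d.σ ℓ θ = -θ) :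
    ∀ (x y : ringClassField K ι ℓ) (h : (W.baseChange (ringClassField K ι ℓ)).toAffine.Nonsingular x y),
      (∑ k ∈ range ((ℓ + 1) / 2), pointGalHom W (ringClassField K ι ℓ) ((d.σ ℓ ^ 2) ^ k) d.y) = .some x y h →
        (x : ℂ) ∈ ringClassField K ι 1 ∧
          (((2 * y + (W.baseChange (ringClassField K ι ℓ)).toAffine.a₁ * x +
              (W.baseChange (ringClassField K ι ℓ)).toAffine.a₃) / θ : ringClassField K ι ℓ) : ℂ) ∈
            ringClassField K ι 1 :=
  twistCoords_mem_of_anti hK W hℓK.1 d hθ hσθ (pointGalHom_σ_halfTrace_eq_neg W hCM hK hodd h3 hH hℓK hℓF d)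

/-- **The genus point `g_d = Σ_{s∈S} s(A)` is (the transport of) a `K[1]`-point of `E^{(ℓ*)}`** (same frame): `σ_ℓ g_d = −g_d`
(p800829 `pointGalHom_σ_genusPoint_eq_neg`), so `g_d = O` or its twist coordinates lie in `K[1]`. Together with
`two_dvd_derivedPoint_iff_exists_ringClassField_one_twistCoords`: at a shallow CM-inert Kolyvagin prime on H₂ the clause
`P_d(ℓ) ∉ 2E(K[ℓ])` is a level-ONE `2`-indivisibility statement inside the image of `E^{(ℓ)}(K[1])` in `E(K[1](√ℓ))`.
[cite: GrossLMS1991, §3 (3.5), Prop. 3.7 (1), §4 (4.1)] [cite: SilvermanAEC2009, X.5 Cor. 5.4] -/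
theorem genusPoint_twistCoords_mem (W : WeierstrassCurve ℚ) [W.IsElliptic] [W.IsGloballyMinimal]
    [NeZero (W.conductorNorm ℤ)] (hCM : W.HasCM) (hK : IsImaginaryQuadratic K)
    (hodd : Odd (NumberField.discr K)) (h3 : NumberField.discr K ≠ -3)
    (hH : SatisfiesHeegnerHypothesis (W.conductorNorm ℤ) K)
    {Dt : ModularParametrizationData W (W.conductorNorm ℤ)} {β : ℤ} {ι : K →+* ℂ} {ℓ : ℕ}
    (hℓK : Zhang2014.IsKolyvaginPrime (W.conductorNorm ℤ) W K 2 ℓ) (hℓF : CMInert W ℓ)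
    (d : KolyvaginHeegnerData Dt β ι ℓ) {θ : ringClassField K ι ℓ} (hθ : θ ≠ 0) (hσθ : d.σ ℓ θ = -θ) :
    ∀ (x y : ringClassField K ι ℓ) (h : (W.baseChange (ringClassField K ι ℓ)).toAffine.Nonsingular x y),
      (∑ s ∈ d.S, pointGalHom W (ringClassField K ι ℓ) s
          (∑ k ∈ range ((ℓ + 1) / 2), pointGalHom W (ringClassField K ι ℓ) ((d.σ ℓ ^ 2) ^ k) d.y)) = .some x y h →
        (x : ℂ) ∈ ringClassField K ι 1 ∧
          (((2 * y + (W.baseChange (ringClassField K ι ℓ)).toAffine.a₁ * x +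
              (W.baseChange (ringClassField K ι ℓ)).toAffine.a₃) / θ : ringClassField K ι ℓ) : ℂ) ∈
            ringClassField K ι 1 :=
  twistCoords_mem_of_anti hK W hℓK.1 d hθ hσθ (pointGalHom_σ_genusPoint_eq_neg W hCM hK hodd h3 hH hℓK hℓF d)

end Summit.BirchSwinnertonDyer.BirchSwinnertonDyer.Theorems.CMKolyvaginConjecturePositiveDepth

end
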